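import Mathlib
import Summits.NavierStokesRegularity.NavierStokesRegularity.Theorems.TypeIQuarterGateScarEnvelopeTypeIZoomDictionaryDefs
import Summits.NavierStokesRegularity.NavierStokesRegularity.Theorems.TypeIQuarterGateScarEnvelopeTypeIFatKill
import Summits.NavierStokesRegularity.NavierStokesRegularity.Theorems.TypeIQuarterGateScarEnvelopeTypeIBudgetViolators
import Summits.NavierStokesRegularity.NavierStokesRegularity.Theorems.TypeIQuarterGateScarEnvelopeTypeIOfNoTwinScarObject
import Summits.NavierStokesRegularity.NavierStokesRegularity.Theorems.TypeIQuarterGateQuarterLawTypeIGlue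
import Summits.NavierStokesRegularity.NavierStokesRegularity.Theorems.TypeIQuarterGateEnvelopeQuarterLaw
import Summits.NavierStokesRegularity.NavierStokesRegularity.Theorems.TypeIQuarterGateScarEnvelopeTypeINearOneRateDss
import Literature.Analysis.FluidPDE.AncientAxisymmetricTypeILiouville
import Summits.NavierStokesRegularity.NavierStokesRegularity.Theorems.TypeIQuarterGateScarEnvelopeTypeIZoomDictionaryPersistence
import Summits.NavierStokesRegularity.NavierStokesRegularity.Theorems.TypeIQuarterGateScarEnvelopeTypeISatelliteTowerDefs
import Summits.NavierStokesRegularity.NavierStokesRegularity.Theorems.TypeIQuarterGateScarEnvelopeTypeISatelliteTowerObjects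
import Summits.NavierStokesRegularity.NavierStokesRegularity.Theorems.TypeIQuarterGateScarEnvelopeTypeISatelliteTowerClosure
import Summits.NavierStokesRegularity.NavierStokesRegularity.Theorems.TypeIQuarterGateScarEnvelopeTypeISatelliteTowerCensus
import Summits.NavierStokesRegularity.NavierStokesRegularity.Theorems.TypeIQuarterGateScarEnvelopeTypeISatelliteTowerExclusions
import Summits.NavierStokesRegularity.NavierStokesRegularity.Theorems.TypeIQuarterGateScarEnvelopeTypeISatelliteTowerEnvelopeDefs
import Summits.NavierStokesRegularity.NavierStokesRegularity.Theorems.TypeIQuarterGateScarEnvelopeTypeISatelliteTowerEnvelopeTame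

/-!
# Part L5–L8: ENVELOPED LEAVES, the sharpened assembly, the tree's partial Liouville theorems on leaves, ★ TAME ⟺ ENVELOPED, and the factorisation of the final-time Type-I Liouville statement

Part L5–L8 of the ROUND-32 plate: `envelopedLeaf_of_tameNode`, the sharpened assembly through enveloped leaves, the tree's partial Liouville theorems (axisymmetric / near-one DSS) read on enveloped leaves BY NAME, the converse ENVELOPED ⇒ TAME (`ABTower.budgetAt_iff_enveloped`), and ★★ `typeILiouvilleAB_iff : TypeILiouvilleAB ↔ (no rooted node) ∧ (no enveloped leaf)` with `scarEnvelopeTypeI_of_noRooted`.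

PROVENANCE: declaration texts VERBATIM from the HOME plates of the instrument seat nsreg-p3 (g24/g25, cell
`pub/ns-regularity-ideate`): `round-31/Tangent31prep.lean` v5 (sha16 `e5b8668e3a090216`; = ROUND-30 plate v10 + Part K) and,
for Part L, `round-32/Tangent32prep.lean` v6 (sha16 `6123f27718636121`);
the author cannot write under `Theorems/` (`perm.theorems-prover-only`); landed by the
LEAD-lineage prover ns-sz-p1 g5 on director-ns DIRECTOR-NS #218 (2), split into ≤ 400-line modules (the
plate's `def`s gathered in `TypeIQuarterGateScarEnvelopeTypeIZoomDictionaryDefs`), namespace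
`Summit.NavierStokesRegularity.NavierStokesRegularity.Cruxes.ScarEnvelopeTypeI.ZoomDictionary` (the plate's `NsregP3.R30P`), `E3` spelled out, one-line docstrings
added where the plate had none.  `--supports stmt-NavierStokesRegularity-23843 --as helper`.

HONEST FRAMING: dictionary / census TOOLING for the crux `TypeIQuarterGate.ScarEnvelopeTypeI` (item 23843):
equivalences and normal forms, kernel-checked; NO open statement is proved — 23843, its parent
`QuarterLawTypeI` (23726), the route and Navier–Stokes regularity are OPEN; hard core evaded: none.
-/

-- the summit-side namespace repeats a component by design (single-conjunct summit, D-0017)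
set_option linter.dupNamespace false

open MeasureTheory Set Metric Filter Topology
open scoped ENNReal

namespace Summit.NavierStokesRegularity.NavierStokesRegularity.Cruxes.ScarEnvelopeTypeI.ZoomDictionary

variable {u : ℝ → (EuclideanSpace ℝ (Fin 3)) → (EuclideanSpace ℝ (Fin 3))} {a : (EuclideanSpace ℝ (Fin 3))} {ν T : ℝ}

section Tower

open Literature.Analysis.FluidPDE
variable {U : ℝ → (EuclideanSpace ℝ (Fin 3)) → (EuclideanSpace ℝ (Fin 3))} {P : ℝ → (EuclideanSpace ℝ (Fin 3)) → ℝ} {y' : (EuclideanSpace ℝ (Fin 3))} {ν : ℝ}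
open Summit.NavierStokesRegularity.NavierStokesRegularity.Cruxes.ScarEnvelopeTypeI.ScarZoom
  (CruxHypotheses ScarViolators TwinScarObject singularAt_of_isBackwardSingularPoint
    exists_localEnergy_of_typeIBound) in

/-! #### L5. ENVELOPED LEAVES and the sharpened assembly -/

/-- The envelope makes every final-time point `(0, y)`, `y ≠ 0`, regular (bound `2A/‖y‖` on
`Q_{‖y‖/2}(0, y)`). -/
theorem regPt_of_hasTypeIDecay {A : ℝ} (hdec : HasTypeIDecay A U) {y : (EuclideanSpace ℝ (Fin 3))} (hy : y ≠ 0) :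
    RegPt U y := by
  have hy2 : 0 < ‖y‖ / 2 := by positivity
  refine ⟨‖y‖ / 2, hy2, A / (‖y‖ / 2),
    (ae_restrict_mem (isOpen_parabolicCylinder _ _).measurableSet).mono fun z hz => ?_⟩
  rw [mem_parabolicCylinder] at hz
  obtain ⟨⟨-, hz2⟩, hz3⟩ := hz
  have ht : z.1 < 0 := by simpa using hz2
  have hdist : dist z.2 y < ‖y‖ / 2 := by simpa using hz3
  have h1 := hdec z.1 ht z.2
  have hden : 0 < ‖z.2‖ + Real.sqrt (-z.1) :=
    add_pos_of_nonneg_of_pos (norm_nonneg _) (Real.sqrt_pos.2 (neg_pos.2 ht))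
  have hA : 0 ≤ A := by
    by_contra hA
    push Not at hA
    exact absurd ((norm_nonneg _).trans h1) (not_le.2 (div_neg_of_neg_of_pos hA hden))
  have hle : ‖y‖ / 2 ≤ ‖z.2‖ + Real.sqrt (-z.1) := by
    have h2 : ‖y‖ - ‖z.2‖ ≤ dist z.2 y := by
      rw [dist_comm, dist_eq_norm]; exact norm_sub_norm_le _ _
    linarith [Real.sqrt_nonneg (-z.1)]
  exact h1.trans (div_le_div_of_nonneg_left hA hy2 hle)

/-- **An enveloped leaf is a one-scar leaf** (K12): (E1⁺) «no enveloped leaf» is WEAKER than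
(E1) «no one-scar leaf». -/
theorem EnvelopedLeaf.oneScarLeaf {M A : ℝ} (h : EnvelopedLeaf M A) : OneScarLeaf M := by
  obtain ⟨U, P, H, hAB, hdec, h0⟩ := h
  exact ⟨U, P, H, hAB, h0, fun y hy _ => regPt_of_hasTypeIDecay hdec hy⟩

/-- The one-scar Liouville statement `∀ M, ¬ OneScarLeaf M` implies the enveloped exclusion `∀ M A, ¬ EnvelopedLeaf M A` (an enveloped leaf is a one-scar leaf). [folklore] -/
theorem noEnvelopedLeaf_of_noOneScarLeaf (h : ∀ M : ℝ, ¬ OneScarLeaf M) :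
    ∀ M A : ℝ, ¬ EnvelopedLeaf M A := fun M _ hE => h M hE.oneScarLeaf

/-- **A TAME ROOTED NODE PRODUCES AN ENVELOPED LEAF OF THE SAME RATE** (L3 + L4 + K12): the field
of a tame node is enveloped at its tame point (L3), some tangent flow there exists (K12) and is
singular at the origin (K6/K12), and its A–B representative carries the envelope globally (L4). -/
theorem envelopedLeaf_of_tameNode {M : ℝ} {n : TNode} (hn : RootedNode M n) (ht : TameNode n) :
    ∃ A : ℝ, EnvelopedLeaf M A := by
  have hT : TowerObj M n.U n.P := towerObj_of_abTower hn.1.1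
  obtain ⟨A, δ, hδ, henv⟩ := hT.envelope_of_budgetAt ht.2
  obtain ⟨L, Ū, hŪ⟩ := exists_tangentU_of_towerObj hT n.y
  have h0 : ¬ RegPt Ū 0 := (oneScar_of_tameNode hn.1 ht hŪ).1
  obtain ⟨U', P', H', hAB', hdec, hae⟩ := abTower_closed_decay hn.1.1 hŪ hδ henv
  exact ⟨A, U', P', H', hAB', hdec,
    fun h => h0 ((regPt_iff_of_ae_eq_of_norm_lt_one hae (by simp)).2 h)⟩

open Summit.NavierStokesRegularity.NavierStokesRegularity.Cruxes.ScarEnvelopeTypeI in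
/-- **ASSEMBLY, enveloped form (proved): (E1⁺) NO ENVELOPED LEAF + (E2) NO INFINITE ROOTED DESCENT
⇒ the crux item 23843.**  Both hypotheses are OPEN; (E1⁺) is the Liouville-type conjecture for the
KNSS-gauge Type-I class WITH the space–time envelope (1.6), restricted to fields singular at the
origin — weaker than (E1) of K12 (`noEnvelopedLeaf_of_noOneScarLeaf`). -/
theorem scarEnvelopeTypeI_of_noEnvelopedLeaf_noDescent
    (hE : ∀ M A : ℝ, ¬ EnvelopedLeaf M A) (hI : ∀ M : ℝ, ¬ InfiniteDescent M) :
    Summit.NavierStokesRegularity.NavierStokesRegularity.Theses.TypeIQuarterGate.ScarEnvelopeTypeI :=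
  scarEnvelopeTypeI_of_noTame_noDescent
    (fun M _ hn ht => by
      obtain ⟨A, hA⟩ := envelopedLeaf_of_tameNode hn ht
      exact hE M A hA)
    hI

/-! #### L6. The tree's partial Liouville theorems, read on enveloped leaves BY NAME -/

/-- **No enveloped leaf is axisymmetric about any axis** — KNSS 2009 Thm 5.3 in the tree
(`IsAncientMildSolution.ae_eq_zero_of_isAxisymmetric_conj_of_hasTypeIDecay`): an A–B object with the
envelope whose slices are axisymmetric about the axis `R e₃` vanishes, hence is regular at `0`. -/
theorem ABTower.regPt_zero_of_isAxisymmetric_conj {M A : ℝ} {H : ℝ → (EuclideanSpace ℝ (Fin 3)) → (EuclideanSpace ℝ (Fin 3)) →L[ℝ] (EuclideanSpace ℝ (Fin 3))}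
    (hAB : ABTower M U P H) (hdec : HasTypeIDecay A U) (R : (EuclideanSpace ℝ (Fin 3)) ≃ₗᵢ[ℝ] (EuclideanSpace ℝ (Fin 3)))
    (haxi : ∀ t < 0, IsAxisymmetric (fun x => R.symm (U t (R x)))) : RegPt U 0 := by
  have hm := hAB.1
  have hzero : ∀ t < 0, U t =ᵐ[volume] 0 :=
    IsAncientMildSolution.ae_eq_zero_of_isAxisymmetric_conj_of_hasTypeIDecay
      hm.isAncientMildSolution (fun t ht => hm.aestronglyMeasurable_slice ht) R haxi hdec
  have hzero' : ∀ t < 0, ∀ x, U t x = 0 := fun t ht x => by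
    have h := ((hm.continuous_slice ht).ae_eq_iff_eq (μ := volume) continuous_const).1
      (hzero t ht)
    exact congrFun h x
  refine ⟨1, one_pos, 0,
    (ae_restrict_mem (isOpen_parabolicCylinder 1 _).measurableSet).mono fun z hz => ?_⟩
  have hz1 : z.1 < 0 := (Set.mem_prod.1 (parabolicCylinder_subset_lowerHalf 1 (0 : (EuclideanSpace ℝ (Fin 3))) hz)).1
  rw [hzero' z.1 hz1 z.2, norm_zero]

/-- No enveloped leaf is axisymmetric about any axis (any rigid motion `R`): the tree's axisymmetric Type-I ancient Liouville theorem read on enveloped leaves. [folklore] -/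
theorem EnvelopedLeaf.not_isAxisymmetric_conj {M A : ℝ} :
    ¬ ∃ (U : ℝ → (EuclideanSpace ℝ (Fin 3)) → (EuclideanSpace ℝ (Fin 3))) (P : ℝ → (EuclideanSpace ℝ (Fin 3)) → ℝ) (H : ℝ → (EuclideanSpace ℝ (Fin 3)) → (EuclideanSpace ℝ (Fin 3)) →L[ℝ] (EuclideanSpace ℝ (Fin 3))) (R : (EuclideanSpace ℝ (Fin 3)) ≃ₗᵢ[ℝ] (EuclideanSpace ℝ (Fin 3))),
      ABTower M U P H ∧ HasTypeIDecay A U ∧ ¬ RegPt U 0 ∧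
        ∀ t < 0, IsAxisymmetric (fun x => R.symm (U t (R x))) := by
  rintro ⟨U, P, H, R, hAB, hdec, h0, haxi⟩
  exact h0 (hAB.regPt_zero_of_isAxisymmetric_conj hdec R haxi)

open Summit.NavierStokesRegularity.NavierStokesRegularity.Cruxes.ScarEnvelopeTypeI in
/-- **No enveloped leaf is near-one DSS about the origin, envelope threshold** — Chae–Wolf 2017
Thm 1.3 in the tree (`AxisActivity.nearOneEnvelope_inTree`): the threshold `c₁(A)` depends on the
ENVELOPE constant of the leaf. -/
theorem envelopedLeaf_not_dss_envelope {A : ℝ} (hA : 0 < A) :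
    ∃ c₁ : ℝ, 1 < c₁ ∧ ∀ (M c : ℝ), 1 < c → c < c₁ →
      ∀ (U : ℝ → (EuclideanSpace ℝ (Fin 3)) → (EuclideanSpace ℝ (Fin 3))) (P : ℝ → (EuclideanSpace ℝ (Fin 3)) → ℝ) (H : ℝ → (EuclideanSpace ℝ (Fin 3)) → (EuclideanSpace ℝ (Fin 3)) →L[ℝ] (EuclideanSpace ℝ (Fin 3))), ABTower M U P H →
        HasTypeIDecay A U → IsDiscretelySelfSimilar c U → RegPt U 0 := by
  obtain ⟨c₁, hc₁, h⟩ := AxisActivity.nearOneEnvelope_inTree hA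
  refine ⟨c₁, hc₁, fun M c hc hcc U P H hAB hdec hdss => ?_⟩
  have hzero := h M c U hc hcc hAB.1 hdec hdss
  refine ⟨1, one_pos, 0,
    (ae_restrict_mem (isOpen_parabolicCylinder 1 _).measurableSet).mono fun z hz => ?_⟩
  have hz1 : z.1 < 0 := (Set.mem_prod.1 (parabolicCylinder_subset_lowerHalf 1 (0 : (EuclideanSpace ℝ (Fin 3))) hz)).1
  rw [hzero z.1 hz1 z.2, norm_zero]

/-- **… and rate threshold, about any centre** — K11 (`abTower_not_nearOneDss`, from the tree's
`AxisActivity.nearOneRateDss_proof`): the threshold `c₁(M)` depends on the RATE only, hence is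
uniform over all leaves of all census chains of one blow-up. -/
theorem envelopedLeaf_not_dss_rate (M : ℝ) :
    ∃ c₁ : ℝ, 1 < c₁ ∧ ∀ c : ℝ, 1 < c → c < c₁ → ∀ (A : ℝ)
      (U : ℝ → (EuclideanSpace ℝ (Fin 3)) → (EuclideanSpace ℝ (Fin 3))) (P : ℝ → (EuclideanSpace ℝ (Fin 3)) → ℝ) (H : ℝ → (EuclideanSpace ℝ (Fin 3)) → (EuclideanSpace ℝ (Fin 3)) →L[ℝ] (EuclideanSpace ℝ (Fin 3))), ABTower M U P H →
        HasTypeIDecay A U → ¬ RegPt U 0 → ∀ x₀ : (EuclideanSpace ℝ (Fin 3)),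
          ¬ IsDiscretelySelfSimilar c (fun t x => U t (x + x₀)) := by
  obtain ⟨c₁, hc₁, h⟩ := abTower_not_nearOneDss M
  exact ⟨c₁, hc₁, fun c hc hcc A U P H hAB _ h0 x₀ => h c hc hcc U P H hAB h0 x₀⟩

/-- **Scoreboard of the enveloped assembly** (informational conjunction): the assembly, the
comparison with K12's (E1), and the two by-name partial kills. -/
theorem envelopedLeaf_scoreboard :
    ((∀ M A : ℝ, ¬ EnvelopedLeaf M A) → (∀ M : ℝ, ¬ InfiniteDescent M) →
      Summit.NavierStokesRegularity.NavierStokesRegularity.Theses.TypeIQuarterGate.ScarEnvelopeTypeI) ∧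
    ((∀ M : ℝ, ¬ OneScarLeaf M) → ∀ M A : ℝ, ¬ EnvelopedLeaf M A) ∧
    (∀ (M : ℝ) (n : TNode), RootedNode M n → TameNode n → ∃ A : ℝ, EnvelopedLeaf M A) :=
  ⟨scarEnvelopeTypeI_of_noEnvelopedLeaf_noDescent, noEnvelopedLeaf_of_noOneScarLeaf,
    fun _ _ hn ht => envelopedLeaf_of_tameNode hn ht⟩

/-! #### L7. The converse dictionary: ENVELOPED ⇒ TAME.  ★ TAME ⟺ ENVELOPED -/

/-- **ENVELOPED ⇒ TAME.**  If an A–B object obeys the local space–time envelope at `(0, y')`, the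
slice budget holds at `y'`: every tangent flow at `y'` carries the envelope globally (L4), hence is
regular off the origin (L5 `regPt_of_hasTypeIDecay`), and the dictionary (K6) concludes. -/
theorem ABTower.budgetAt_of_envelope {M : ℝ} {H : ℝ → (EuclideanSpace ℝ (Fin 3)) → (EuclideanSpace ℝ (Fin 3)) →L[ℝ] (EuclideanSpace ℝ (Fin 3))} (h : ABTower M U P H)
    {y' : (EuclideanSpace ℝ (Fin 3))} {A δ : ℝ} (hδ : 0 < δ)
    (henv : ∀ t ∈ Ioo (-(δ ^ 2)) 0, ∀ x ∈ ball y' δ, ‖U t x‖ ≤ A / (‖x - y'‖ + Real.sqrt (-t))) :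
    BudgetAt 1 0 U y' := by
  refine (towerDictionary_inBall (towerObj_of_abTower h) y').2 fun L Ū ht z hz0 hz1 => ?_
  obtain ⟨U', P', H', -, hdec, hae⟩ := abTower_closed_decay h ht hδ henv
  exact (regPt_iff_of_ae_eq_of_norm_lt_one hae hz1).2 (regPt_of_hasTypeIDecay hdec hz0)

/-- ★ **TAME ⟺ ENVELOPED (the slice budget IS the KNSS envelope).**  For an A–B object
`(U, P, H)` (Type-I ancient mild of rate `M`, suitable on every ball, `𝐈 < ∞`) and ANY final-time
point `y'`: the slice budget `BudgetAt 1 0 U y'` (the crux class's `L³`-octave functional condition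
of the registered 23843 skeleton `slice_budget`) holds at `y'` IF AND ONLY IF `U` obeys the KNSS
space–time Type-I envelope (1.6) `‖U(t,x)‖ ≤ A/(‖x − y'‖ + √(−t))` on a backward neighbourhood of
`(0, y')`. -/
theorem ABTower.budgetAt_iff_enveloped {M : ℝ} {H : ℝ → (EuclideanSpace ℝ (Fin 3)) → (EuclideanSpace ℝ (Fin 3)) →L[ℝ] (EuclideanSpace ℝ (Fin 3))} (h : ABTower M U P H)
    (y' : (EuclideanSpace ℝ (Fin 3))) :
    BudgetAt 1 0 U y' ↔ ∃ A δ : ℝ, 0 < δ ∧ ∀ t ∈ Ioo (-(δ ^ 2)) 0, ∀ x ∈ ball y' δ,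
      ‖U t x‖ ≤ A / (‖x - y'‖ + Real.sqrt (-t)) :=
  ⟨fun hb => (towerObj_of_abTower h).envelope_of_budgetAt hb,
    fun ⟨_, _, hδ, henv⟩ => h.budgetAt_of_envelope hδ henv⟩

/-! #### L8. Where the enveloped exclusion sits: the FACTORISATION of the final-time Type-I
Liouville for the A–B class (ref3's (L′)) as «NO ROOTED NODE» ∧ «NO ENVELOPED LEAF» -/

/-- Persistence at ANY final-time point (T2 without the restriction `y' ≠ 0`): a tangent flow of a
tower object at a point where the object is singular is singular at the origin. -/
theorem TowerObj.not_regPt_tangentU_zero {M : ℝ} (hT : TowerObj M U P) {y' : (EuclideanSpace ℝ (Fin 3))}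
    (hy : ¬ RegPt U y') {L : ℕ → ℝ} {Ū : ℝ → (EuclideanSpace ℝ (Fin 3)) → (EuclideanSpace ℝ (Fin 3))} (hTan : TangentU U P y' 0 L Ū) :
    ¬ RegPt Ū 0 := by
  intro hreg
  obtain ⟨hL, hL0, pbar, hR⟩ := hTan
  have hIB := hT.1
  obtain ⟨C, hCt, L₁, hL₁, hBdd⟩ := (zoomsBddU_tshift_iff).1 (hT.inputs y').2.2.2
  -- shift the scales below `L₁`
  obtain ⟨k₀, hk₀⟩ := Filter.eventually_atTop.1 (hL0.eventually (Iic_mem_nhds hL₁))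
  set L' : ℕ → ℝ := fun k => L (k + k₀) with hL'def
  have hL' : ∀ k, 0 < L' k := fun k => hL _
  have hL'1 : ∀ k, L' k ≤ L₁ := fun k => hk₀ _ (Nat.le_add_left k₀ k)
  set v : ℕ → ℝ → (EuclideanSpace ℝ (Fin 3)) → (EuclideanSpace ℝ (Fin 3)) := fun k => zoom U y' 0 (L' k) with hvdef
  set q : ℕ → ℝ → (EuclideanSpace ℝ (Fin 3)) → ℝ := fun k => zoomP P y' 0 (L' k) with hqdef
  have hρ : (0 : ℝ) < 1 / 2 := by norm_num
  obtain ⟨h2, -, h4, h5⟩ := hR (1 / 2) ⟨hρ, by norm_num⟩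
  have hsub : parabolicCylinder (1 / 2) (0 : ℝ × (EuclideanSpace ℝ (Fin 3))) ⊆ parabolicCylinder 1 (0 : ℝ × (EuclideanSpace ℝ (Fin 3))) :=
    parabolicCylinder_mono hρ.le (by norm_num) _
  have h1 : ∀ k, IsSuitableWeakSolutionInBall (1 / 2) (0 : ℝ × (EuclideanSpace ℝ (Fin 3))) (v k) (q k) := fun k =>
    (inBall_one_zoom hIB y' (hL' k)).of_subset_zero hρ hsub
  have hμ : volume.restrict (parabolicCylinder (1 / 2) (0 : ℝ × (EuclideanSpace ℝ (Fin 3)))) ≤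
      volume.restrict (parabolicCylinder 1 (0 : ℝ × (EuclideanSpace ℝ (Fin 3)))) := Measure.restrict_mono hsub le_rfl
  have h3 : (⨆ k, eLpNorm (Function.uncurry (v k)) 3
        (volume.restrict (parabolicCylinder (1 / 2) (0 : ℝ × (EuclideanSpace ℝ (Fin 3))))) +
      eLpNorm (Function.uncurry (q k)) (3 / 2)
        (volume.restrict (parabolicCylinder (1 / 2) (0 : ℝ × (EuclideanSpace ℝ (Fin 3)))))) < ⊤ := by
    refine lt_of_le_of_lt (iSup_le fun k => ?_) hCt
    exact (add_le_add (eLpNorm_mono_measure _ hμ) (eLpNorm_mono_measure _ hμ)).trans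
      (hBdd (L' k) (hL' k) (hL'1 k))
  obtain ⟨r, hr, M', hev⟩ := persistenceU_holds v q Ū pbar 0 (1 / 2) hρ h1 h2 h3
    (h4.comp (tendsto_add_atTop_nat k₀)) (fun g hg => (h5 g hg).comp (tendsto_add_atTop_nat k₀))
    hreg
  obtain ⟨k, hk⟩ := hev.exists
  exact hy (regPt_of_regPt_zoom_zero (hL' k) ⟨r, hr, M', hk⟩)

/-- **Under «no rooted node» a field of the class singular at the origin is TAME AT ITS ROOT**: a
tangent flow at `0` with a satellite would be (K8) a rooted node. -/
theorem budgetAt_zero_of_noRooted (hno : ∀ (M : ℝ) (n : TNode), ¬ RootedNode M n) {M : ℝ}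
    {H : ℝ → (EuclideanSpace ℝ (Fin 3)) → (EuclideanSpace ℝ (Fin 3)) →L[ℝ] (EuclideanSpace ℝ (Fin 3))} (h : ABTower M U P H) (h0 : ¬ RegPt U 0) : BudgetAt 1 0 U 0 := by
  refine (towerDictionary_inBall (towerObj_of_abTower h) 0).2 fun L Ū ht z hz0 hz1 => ?_
  by_contra hz
  obtain ⟨U', P', H', hAB', hae⟩ := abTower_closed h ht
  have h0' : ¬ RegPt U' 0 := fun hr => (towerObj_of_abTower h).not_regPt_tangentU_zero h0 ht
    ((regPt_iff_of_ae_eq_of_norm_lt_one hae (by simp)).2 hr)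
  have hz' : ¬ RegPt U' z := fun hr => hz ((regPt_iff_of_ae_eq_of_norm_lt_one hae hz1).2 hr)
  exact hno M ⟨U', P', H', z⟩ ⟨⟨hAB', hz0, hz'⟩, h0'⟩

/-- **… hence ENVELOPED AT ITS ROOT, and its tangent flows there are ENVELOPED LEAVES.** -/
theorem envelopedLeaf_of_noRooted (hno : ∀ (M : ℝ) (n : TNode), ¬ RootedNode M n) {M : ℝ}
    {H : ℝ → (EuclideanSpace ℝ (Fin 3)) → (EuclideanSpace ℝ (Fin 3)) →L[ℝ] (EuclideanSpace ℝ (Fin 3))} (h : ABTower M U P H) (h0 : ¬ RegPt U 0) :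
    ∃ A : ℝ, EnvelopedLeaf M A := by
  have hT : TowerObj M U P := towerObj_of_abTower h
  obtain ⟨A, δ, hδ, henv⟩ := hT.envelope_of_budgetAt (budgetAt_zero_of_noRooted hno h h0)
  obtain ⟨L, Ū, hŪ⟩ := exists_tangentU_of_towerObj hT 0
  have hŪ0 : ¬ RegPt Ū 0 := hT.not_regPt_tangentU_zero h0 hŪ
  obtain ⟨U', P', H', hAB', hdec, hae⟩ := abTower_closed_decay h hŪ hδ henv
  exact ⟨A, U', P', H', hAB', hdec,
    fun hr => hŪ0 ((regPt_iff_of_ae_eq_of_norm_lt_one hae (by simp)).2 hr)⟩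

/-- ★★ **THE FACTORISATION.**  The final-time Type-I Liouville for the A–B class is EQUIVALENT to
the conjunction of «NO ROOTED NODE» (⟺ the census exclusions in weakest form ⟺ scar_zoom's S_C′ in
A–B packaging, ref3 F2; sufficient for 23843 by `scarEnvelopeTypeI_of_noTame_noDescent`) and
«NO ENVELOPED LEAF» (the KNSS-envelope Liouville (E1⁺) at fields singular at the origin): the two
residual enemies — TWIN SCARS and ENVELOPED ONE-SCAR FIELDS — are COMPLEMENTARY FACTORS of Type-I
exclusion in the class. -/
theorem typeILiouvilleAB_iff :
    TypeILiouvilleAB ↔ (∀ (M : ℝ) (n : TNode), ¬ RootedNode M n) ∧ ∀ M A : ℝ, ¬ EnvelopedLeaf M A := by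
  refine ⟨fun h => ⟨fun M n hn => hn.2 (h M _ _ _ hn.1.1), fun M A hE => ?_⟩,
    fun hh M U P H hAB => ?_⟩
  · obtain ⟨U, P, H, hAB, -, h0⟩ := hE
    exact h0 (h M U P H hAB)
  · by_contra h0
    obtain ⟨A, hA⟩ := envelopedLeaf_of_noRooted hh.1 hAB h0
    exact hh.2 M A hA

/-- «No rooted node» ⟺ the census exclusions in weakest form (ref3 F2, re-proved). -/
theorem noRooted_iff :
    (∀ (M : ℝ) (n : TNode), ¬ RootedNode M n) ↔
      (∀ (M : ℝ) (n : TNode), RootedNode M n → ¬ TameNode n) ∧ ∀ M : ℝ, ¬ InfiniteDescent M := by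
  refine ⟨fun h => ⟨fun M n hn _ => h M n hn, fun M hI => ?_⟩, fun hh M n hn => ?_⟩
  · obtain ⟨c, hc⟩ := hI
    exact h M (c 0) (hc 0).1
  · rcases rooted_census hn with ⟨c, k, -, -, hch, htame⟩ | ⟨c, -, hc⟩
    · exact hh.1 M (c k) (hch k le_rfl) htame
    · exact hh.2 M ⟨c, hc⟩

/-- «No rooted node» ⟺ «every A–B object singular at the final-time origin has NO satellite»
(scar_zoom's S_C′ in A–B packaging, ref3 F2). -/
theorem noRooted_iff_noSatellites :
    (∀ (M : ℝ) (n : TNode), ¬ RootedNode M n) ↔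
      ∀ (M : ℝ) (U : ℝ → (EuclideanSpace ℝ (Fin 3)) → (EuclideanSpace ℝ (Fin 3))) (P : ℝ → (EuclideanSpace ℝ (Fin 3)) → ℝ) (H : ℝ → (EuclideanSpace ℝ (Fin 3)) → (EuclideanSpace ℝ (Fin 3)) →L[ℝ] (EuclideanSpace ℝ (Fin 3))),
        ABTower M U P H → ¬ RegPt U 0 → satellites U = ∅ := by
  refine ⟨fun h M U P H hAB h0 => ?_, fun h M n hn => ?_⟩
  · exact Set.subset_eq_empty (s := (∅ : Set (EuclideanSpace ℝ (Fin 3))))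
      (fun y hy => (h M ⟨U, P, H, y⟩ ⟨⟨hAB, hy⟩, h0⟩).elim) rfl
  · have he := h M n.U n.P n.H hn.1.1 hn.2
    have hy : n.y ∈ satellites n.U := hn.1.2
    rw [he] at hy
    simp at hy

/-- **(E1⁺) ∧ (E2) ⟺ (L′)** — ref3's F1 holds for the enveloped form too: the pair of exclusions
of `scarEnvelopeTypeI_of_noEnvelopedLeaf_noDescent` is JOINTLY the Type-I non-existence statement
for the class (a costume as an assembly hypothesis; each factor alone is not). -/
theorem envelopedExclusions_iff_typeILiouvilleAB :
    ((∀ M A : ℝ, ¬ EnvelopedLeaf M A) ∧ ∀ M : ℝ, ¬ InfiniteDescent M) ↔ TypeILiouvilleAB := by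
  rw [typeILiouvilleAB_iff, noRooted_iff]
  refine ⟨fun hh => ⟨⟨fun M n hn ht => ?_, hh.2⟩, hh.1⟩, fun hh => ⟨hh.2, hh.1.2⟩⟩
  obtain ⟨A, hA⟩ := envelopedLeaf_of_tameNode hn ht
  exact hh.1 M A hA

open Summit.NavierStokesRegularity.NavierStokesRegularity.Cruxes.ScarEnvelopeTypeI in
/-- **Placement of 23843 in the factorisation**: the FIRST factor alone suffices for the crux item
(the census assembly), and scar_zoom's «no twin-scar object» implies it. -/
theorem scarEnvelopeTypeI_of_noRooted (hno : ∀ (M : ℝ) (n : TNode), ¬ RootedNode M n) :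
    Summit.NavierStokesRegularity.NavierStokesRegularity.Theses.TypeIQuarterGate.ScarEnvelopeTypeI :=
  scarEnvelopeTypeI_of_noTame_noDescent (noRooted_iff.1 hno).1 (noRooted_iff.1 hno).2

open Summit.NavierStokesRegularity.NavierStokesRegularity.Cruxes.ScarEnvelopeTypeI in
/-- scar_zoom's deciding stub «no twin-scar object of any rate» implies «no rooted node of any rate». [folklore] -/
theorem noRooted_of_noTwinScar (h : ∀ (M : ℝ) (v : ℝ → (EuclideanSpace ℝ (Fin 3)) → (EuclideanSpace ℝ (Fin 3))), ¬ ScarZoom.TwinScarObject M v) :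
    ∀ (M : ℝ) (n : TNode), ¬ RootedNode M n :=
  noRooted_iff.2 (noTame_noDescent_of_noTwinScar h)

end Tower

end Summit.NavierStokesRegularity.NavierStokesRegularity.Cruxes.ScarEnvelopeTypeI.ZoomDictionary
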